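import Summits.AnomalousDissipation.AnomalousDissipation.Theorems.MarginalStabilityChainStrainedLayerLawLine
import Mathlib.Analysis.Calculus.Deriv.Shift

/-!
# Translation invariance of the class of the line `contraction-capture` (crux stmt-AnomalousDissipation-3007
`MarginalStabilityChain.StrainedLayerLaw`) and the reduction of `stub_velocityRigidity` to velocity uniqueness

Def-free landing (worker W6 for the lead `prover-line-stmt-AnomalousDissipation-3007-0`, 2026-08-16; the proofs are
worker W3's analysis file `work/stubs/stub_velocityRigidity.lean`, §1–§3, verbatim up to the renaming of the main
theorem) of two facts about the crux's solution class `InClass ν L θ₁ θ₂ u v p` of the line module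
`Theorems/MarginalStabilityChainStrainedLayerLawLine.lean`:

* §1 `InClass.translate` — the class is invariant under `x`-translation by any period `ℓ` of the datum `θ`: the
  translate `(u, v, p)(t, x + ℓ, y)` is again `InClass ν L θ₁ θ₂` with the SAME viscosity, period and datum (every
  clause is invariant under `x ↦ x + ℓ`; `deriv_comp_add_const` for the `x`-slice derivatives).
* §2 the two trivial instances, unconditionally: `velocityRigidity_time_zero` (`t = 0`: periodicity of the datum) and
  `velocityRigidity_one` (`n = 1`: the class's own periodicity clause).
* §3 `velocityRigidity_of_unique` (last; the registered sub-goal) — the kernel-checked reduction "registered stub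
  `stub_velocityRigidity` ⇐ velocity uniqueness in the bare class": if every `InClass ν (nℓ) θ₁ θ₂` solution has
  the velocity of `(u, v)` for `t ≥ 0` (hypothesis inlined verbatim), then `u, v` are `ℓ`-periodic for `t ≥ 0`
  whenever the admissible datum is — compare the solution with its own `ℓ`-translate. Velocity uniqueness in the
  BARE class is OPEN (refuter notes M1/M3: the class imposes no growth condition on `ω`, `∇(u, v)` across the layer);
  the repair is an energy-tails side condition under which the stub is the Majda–Bertozzi energy estimate (Prop. 3.1 /
  Cor. 3.1 and the Remark after Prop. 3.4 of *Vorticity and Incompressible Flow*, CUP 2002) — see the crux evidence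
  `stub_velocityRigidity.md`; nothing of that is asserted here.

No definitions, no facts beyond folklore calculus; standard axioms only.

References: the line module `Theorems/MarginalStabilityChainStrainedLayerLawLine.lean` (`InClass`,
`IsAdmissiblePerturbation`, `InClass.periodic_slices`); Majda–Bertozzi 2002 §1.4 (the stretched 2-D class).
-/

set_option linter.dupNamespace false

noncomputable section

open scoped BigOperators Topology ENNReal
open Filter Set Function MeasureTheory

namespace Summit.AnomalousDissipation.AnomalousDissipation.Theorems.StrainedLayerLaw.ContractionCapture

open Literature.Analysis.FluidPDE Literature.Analysis.FluidPDE.StretchedLayer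
open Summit.AnomalousDissipation.AnomalousDissipation.Theses.MarginalStabilityChain

/-! ## §1 Translation invariance of the class -/

/-- **The class is translation invariant.** If the datum `θ` is `ℓ`-periodic in `x`, the `x`-translate by `ℓ` of an
`InClass ν L θ₁ θ₂` solution is again an `InClass ν L θ₁ θ₂` solution (same viscosity, period, datum): every clause
of the class is invariant under `x ↦ x + ℓ` (`deriv_comp_add_const` for the `x`-slice derivatives), and the datum
clause uses `θ(x + ℓ, y) = θ(x, y)`. [folklore] -/
theorem InClass.translate {ν ℓ L : ℝ} {θ₁ θ₂ : ℝ → ℝ → ℝ} {u v p : ℝ → ℝ → ℝ → ℝ}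
    (h : InClass ν L θ₁ θ₂ u v p) (hθ : ∀ x y : ℝ, θ₁ (x + ℓ) y = θ₁ x y ∧ θ₂ (x + ℓ) y = θ₂ x y) :
    InClass ν L θ₁ θ₂ (fun t x y => u t (x + ℓ) y) (fun t x y => v t (x + ℓ) y)
      (fun t x y => p t (x + ℓ) y) := by
  dsimp only [InClass] at h ⊢
  obtain ⟨hu, hv, hp, hu0, hv0, hpde, hperL, hfar, hdat⟩ := h
  have hT : ∀ {m : WithTop ℕ∞}, ContDiff ℝ m (fun q : ℝ × ℝ × ℝ => (q.1, q.2.1 + ℓ, q.2.2)) := by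
    intro m
    fun_prop
  have hmaps : ∀ S : Set ℝ, MapsTo (fun q : ℝ × ℝ × ℝ => (q.1, q.2.1 + ℓ, q.2.2))
      (S ×ˢ (univ : Set (ℝ × ℝ))) (S ×ˢ (univ : Set (ℝ × ℝ))) :=
    fun S q hq => ⟨(Set.mem_prod.1 hq).1, mem_univ _⟩
  have hTc : Continuous (fun q : ℝ × ℝ × ℝ => (q.1, q.2.1 + ℓ, q.2.2)) := (hT (m := 0)).continuous
  refine ⟨hu.comp hT.contDiffOn (hmaps _), hv.comp hT.contDiffOn (hmaps _), hp.comp hT.contDiffOn (hmaps _),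
    hu0.comp hTc.continuousOn (hmaps _), hv0.comp hTc.continuousOn (hmaps _),
    ?_, ?_, ?_, ?_⟩
  · -- the equations at `(t, x, y)` for the translate are the equations at `(t, x + ℓ, y)`
    intro t x y ht
    have key := hpde t (x + ℓ) y ht
    have e_ux : deriv (fun s => u t (s + ℓ) y) x = deriv (fun s => u t s y) (x + ℓ) :=
      deriv_comp_add_const (fun s => u t s y) ℓ x
    have e_vx : deriv (fun s => v t (s + ℓ) y) x = deriv (fun s => v t s y) (x + ℓ) :=
      deriv_comp_add_const (fun s => v t s y) ℓ x
    have e_px : deriv (fun s => p t (s + ℓ) y) x = deriv (fun s => p t s y) (x + ℓ) :=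
      deriv_comp_add_const (fun s => p t s y) ℓ x
    have f_ux : (fun s => deriv (fun r => u t (r + ℓ) y) s) = fun s => deriv (fun r => u t r y) (s + ℓ) :=
      funext fun s => deriv_comp_add_const (fun r => u t r y) ℓ s
    have f_vx : (fun s => deriv (fun r => v t (r + ℓ) y) s) = fun s => deriv (fun r => v t r y) (s + ℓ) :=
      funext fun s => deriv_comp_add_const (fun r => v t r y) ℓ s
    have e_uxx : deriv (fun s => deriv (fun r => u t (r + ℓ) y) s) x =
        deriv (fun s => deriv (fun r => u t r y) s) (x + ℓ) := by
      rw [f_ux]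
      exact deriv_comp_add_const (fun s => deriv (fun r => u t r y) s) ℓ x
    have e_vxx : deriv (fun s => deriv (fun r => v t (r + ℓ) y) s) x =
        deriv (fun s => deriv (fun r => v t r y) s) (x + ℓ) := by
      rw [f_vx]
      exact deriv_comp_add_const (fun s => deriv (fun r => v t r y) s) ℓ x
    rw [e_ux, e_vx, e_px, e_uxx, e_vxx]
    exact key
  · -- periodicity with period `L`
    intro t x y ht
    have key := hperL t (x + ℓ) y ht
    rw [add_right_comm x ℓ L] at key
    exact key
  · -- far field
    intro t x ht
    exact hfar t (x + ℓ) ht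
  · -- datum: `θ` is `ℓ`-periodic
    intro x y
    obtain ⟨h1, h2⟩ := hdat (x + ℓ) y
    exact ⟨by rw [h1, (hθ x y).1], by rw [h2, (hθ x y).2]⟩

/-! ## §2 The two trivial instances -/

/-- **`t = 0`:** at the initial time the stub is the `ℓ`-periodicity of the datum `U_B^ν(y) + θ(x, y)`. [folklore] -/
theorem velocityRigidity_time_zero {ν ℓ L : ℝ} {θ₁ θ₂ : ℝ → ℝ → ℝ} {u v p : ℝ → ℝ → ℝ → ℝ}
    (hθ : IsAdmissiblePerturbation ℓ θ₁ θ₂) (h : InClass ν L θ₁ θ₂ u v p) (x y : ℝ) :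
    u 0 (x + ℓ) y = u 0 x y ∧ v 0 (x + ℓ) y = v 0 x y := by
  dsimp only [InClass] at h
  have hdat := h.2.2.2.2.2.2.2.2
  obtain ⟨h1, h2⟩ := hdat (x + ℓ) y
  obtain ⟨h3, h4⟩ := hdat x y
  obtain ⟨e1, e2⟩ := hθ.2.2.1 x y
  exact ⟨by rw [h1, h3, e1], by rw [h2, h4, e2]⟩

/-- **`n = 1`:** with a single cell the stub is the class's own periodicity clause. [folklore] -/
theorem velocityRigidity_one {ν ℓ : ℝ} {θ₁ θ₂ : ℝ → ℝ → ℝ} {u v p : ℝ → ℝ → ℝ → ℝ}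
    (h : InClass ν ((1 : ℕ) * ℓ) θ₁ θ₂ u v p) :
    ∀ t x y : ℝ, 0 ≤ t → u t (x + ℓ) y = u t x y ∧ v t (x + ℓ) y = v t x y := by
  intro t x y ht
  have key := h.periodic_slices t x y
  simp only [Nat.cast_one, one_mul] at key
  rcases ht.eq_or_lt with h0 | hpos
  · subst h0
    dsimp only [InClass] at h
    have hper := h.2.2.2.2.2.2.1 0 x y le_rfl
    simp only [Nat.cast_one, one_mul] at hper
    exact ⟨hper.1, hper.2.1⟩
  · exact key hpos

/-! ## §3 The registered stub `stub_velocityRigidity` from uniqueness of the velocity in the class -/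

/-- **Rigidity from uniqueness (registered sub-goal of the line).** If the velocity of `InClass ν (nℓ) θ₁ θ₂`
solutions is unique (every class solution with the same data has the velocity of `(u, v)` for `t ≥ 0`), then `u, v`
are `ℓ`-periodic for `t ≥ 0` whenever the admissible datum `θ` is: compare `(u, v, p)` with its `ℓ`-translate
(`InClass.translate`). This is the exact logical position of the registered stub `stub_velocityRigidity`: it is the
special case "solution vs. its own translate" of velocity uniqueness in the bare class, which is OPEN (no growth
condition across the layer; repair = an energy-tails side condition, Majda–Bertozzi 2002, Prop. 3.1 / Cor. 3.1).
[folklore] -/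
theorem velocityRigidity_of_unique {ν ℓ : ℝ} {n : ℕ} {θ₁ θ₂ : ℝ → ℝ → ℝ} {u v p : ℝ → ℝ → ℝ → ℝ}
    (huniq : ∀ u' v' p' : ℝ → ℝ → ℝ → ℝ, InClass ν (n * ℓ) θ₁ θ₂ u' v' p' →
      ∀ t x y : ℝ, 0 ≤ t → u' t x y = u t x y ∧ v' t x y = v t x y)
    (hθ : IsAdmissiblePerturbation ℓ θ₁ θ₂) (h : InClass ν (n * ℓ) θ₁ θ₂ u v p) :
    ∀ t x y : ℝ, 0 ≤ t → u t (x + ℓ) y = u t x y ∧ v t (x + ℓ) y = v t x y :=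
  fun t x y ht => huniq _ _ _ (h.translate hθ.2.2.1) t x y ht

end Summit.AnomalousDissipation.AnomalousDissipation.Theorems.StrainedLayerLaw.ContractionCapture

end
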